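import Summits.PneNP.PneNP.Theorems.OneSliceSliceTargetFibreCliqueLower

/-!
# Line `Sketch-ideator3-r1` for crux `SliceTarget` (stmt-PneNP-2832) — stub T3θ `FibreCliqueLowerSub`

Stub `stub_fibreCliqueLowerSub` of the line skeleton `Cruxes/SliceTarget/Lines/Sketch_ideator3_r1.lean` (namespace
`Summit.PneNP.PneNP.Cruxes.SliceTarget.Ideator3Line`): the lower fibre clique bound of T3 (`stub_fibreCliqueLower`,
Theorems/OneSliceSliceTargetFibreCliqueLower.lean) under the sub-threshold read-set cap `8·#F ≤ m_k(n)` instead of `#F ≤ 3n`,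
for every `k ≥ 3`; same second moment (`fcl_fibre_bound`), the window arithmetic redone for the weaker cap. It is the
hypothesis `FibreCliqueLowerSub` of the landed window transfer `stub_transferWindow` (Theorems/OneSliceSliceTargetSubthreshold.lean,
p90126), which turns it into the sub-threshold floor `m_k(n) ≤ 16·size + 8` for accurate circuits.

Proof by lead prover-line-stmt-PneNP-2832-0 (2026-08-16, rc 0 inside skeleton v5–v8); landed by the continuation lead
prover-line-stmt-PneNP-2832-c1-0.
-/

set_option linter.dupNamespace false

namespace Summit.PneNP.PneNP.Cruxes.SliceTarget.Ideator3Line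

open Literature.Computability.Complexity Finset Filter Classical
open scoped Topology
open Summit.PneNP.PneNP.Theorems.ConstantBand.Negative (Edge thr Central slice)
open Summit.PneNP.PneNP.Theorems.SingleThreshold.Negative (Edges zeroOn pc pc_nonneg pc_le_one tendsto_pc
  pc_pow_choose)
open Summit.PneNP.PneNP.Cruxes.ConstantBand.FlatPriorRelativeMinterms (ts_tendsto_T)

noncomputable section

/-- **stub T3θ `stub_fibreCliqueLowerSub`** of line `Sketch-ideator3-r1` (crux stmt-PneNP-2832): T3 with the read-set cap
`#F ≤ 3n` replaced by the sub-threshold cap `8·#F ≤ m_k(n)` and `k ≥ 3` — the free part of every fibre is a uniform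
`(j − r)`-subset of `Fᶜ` with `j − r ≥ (7/8 − o(1))·m_k(n)` and `#Fᶜ ≥ C(n,2) − m_k(n)/8`, so its density stays in the
window `[p/2, 4p]` and the slice second moment `fcl_fibre_bound` applies to the `k`-sets avoiding `F`
(`fcl_choose_le_card_avoiding_add`: all but `(m_k(n)/8)·C(n−2,k−2) = o(C(n,k))` of them). Feeds the sub-threshold floor
`sliceLB_subthreshold_of` / `stub_transferWindow` (Theorems/OneSliceSliceTargetSubthreshold.lean). [folklore] -/
theorem stub_fibreCliqueLowerSub :
    ∀ k : ℕ, 3 ≤ k → ∃ α : ℝ, 0 < α ∧ ∀ᶠ n : ℕ in atTop, ∀ j : ℕ, Central k n j →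
      ∀ F : Finset (Edge n), 8 * #F ≤ thr k n → ∀ ρ : Edge n → Bool,
        α * #((slice n j).filter fun x => ∀ e ∈ F, x e = ρ e) ≤
          #((slice n j).filter fun x => (∀ e ∈ F, x e = ρ e) ∧ cliqueFn n k (zeroOn F x) = true) := by
  intro k hk
  have hk2 : 2 ≤ k := by omega
  have hc₀0 : (0 : ℝ) < 1 / (2 ^ (k + 1) * k.factorial) := by positivity
  refine ⟨1 / (2 ^ (k + 1) * k.factorial) * (1 / 2) ^ (2 * k.choose 2) /
    (4 ^ k.choose 2 * (1 + k * 2 ^ k * (4 : ℝ) ^ k.choose 2)), by positivity, ?_⟩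
  -- `T = C(n,2)·p → ∞`: eventually `T ≥ 8K + 8`
  have hTinf : Tendsto (fun n : ℕ => ((n.choose 2 : ℕ) : ℝ) * pc n k) atTop atTop :=
    (ts_tendsto_T hk).congr fun n => rfl
  have E1 : ∀ᶠ n : ℕ in atTop, 8 * (k.choose 2 : ℝ) + 8 ≤ ((n.choose 2 : ℕ) : ℝ) * pc n k :=
    hTinf.eventually_ge_atTop _
  -- the count error `p/16 → 0`
  have E3 : ∀ᶠ n : ℕ in atTop, pc n k / 16 ≤ 1 / (2 ^ (k + 1) * k.factorial) := by
    have h := (tendsto_pc hk2).div_const 16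
    rw [zero_div] at h
    exact h.eventually (eventually_le_nhds hc₀0)
  filter_upwards [E1, fcl_window hk, E3, eventually_ge_atTop (2 * k + 13)] with n hT8 hwin hpn hn
  obtain ⟨hT1, hwin⟩ := hwin
  intro j hj F hF ρ
  have hn1 : 1 ≤ n := by omega
  have hn1r : (1 : ℝ) ≤ n := by exact_mod_cast hn1
  have hp0 : 0 < pc n k := Real.rpow_pos_of_pos (by linarith) _
  have hp1 : pc n k ≤ 1 := pc_le_one hn1 hk2
  set T : ℝ := ((n.choose 2 : ℕ) : ℝ) * pc n k with hTdef
  -- `#F ≤ thr/8 ≤ T/8 ≤ C(n,2)/8`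
  have hthrT : (thr k n : ℝ) ≤ T := by
    rw [hTdef, thr, pc]
    exact Nat.floor_le (mul_nonneg (Nat.cast_nonneg _) (Real.rpow_nonneg (Nat.cast_nonneg _) _))
  have hF8 : 8 * (#F : ℝ) ≤ T := le_trans (by exact_mod_cast hF) hthrT
  have hNr : (0 : ℝ) ≤ (n.choose 2 : ℕ) := Nat.cast_nonneg _
  have hTN : T ≤ (n.choose 2 : ℕ) := by
    rw [hTdef]
    exact mul_le_of_le_one_right hNr hp1
  have hFN : 8 * #F ≤ n.choose 2 := by
    have : 8 * (#F : ℝ) ≤ (n.choose 2 : ℕ) := hF8.trans hTN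
    exact_mod_cast this
  have hcardV : #((univ : Finset (Edge n)) \ F) = n.choose 2 - #F := by
    rw [card_sdiff_of_subset (subset_univ F), card_univ, card_edgeSet_top_fin]
  have hNpos : 0 < n.choose 2 := Nat.choose_pos (by omega)
  have hV : 0 < #((univ : Finset (Edge n)) \ F) := by
    rw [hcardV]
    omega
  have hVr : ((n.choose 2 : ℕ) : ℝ) / 2 ≤ #((univ : Finset (Edge n)) \ F) := by
    rw [hcardV, Nat.cast_sub (by omega)]
    have : (#F : ℝ) ≤ (n.choose 2 : ℕ) / 8 := by
      have h := hF8.trans hTN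
      linarith
    linarith
  have hVle : (#((univ : Finset (Edge n)) \ F) : ℝ) ≤ (n.choose 2 : ℕ) := by
    exact_mod_cast (hcardV ▸ Nat.sub_le _ _ : #((univ : Finset (Edge n)) \ F) ≤ n.choose 2)
  -- the window facts for the sub-slices `j - r`, `r ≤ #F ≤ T/8`
  have hwin' : ∀ r : ℕ, r ≤ #F → r ≤ j →
      pc n k / 2 ≤ (((j - r : ℕ) : ℝ) + 1 - k.choose 2) / #((univ : Finset (Edge n)) \ F) ∧
      ((j - r : ℕ) : ℝ) / #((univ : Finset (Edge n)) \ F) ≤ 4 * pc n k := by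
    intro r hrF hrj
    obtain ⟨hjlo, hjhi⟩ := hwin j hj
    have hV0 : (0 : ℝ) < #((univ : Finset (Edge n)) \ F) := by exact_mod_cast hV
    have hr8 : 8 * (r : ℝ) ≤ T := le_trans (by exact_mod_cast Nat.mul_le_mul_left 8 hrF) hF8
    have hr0 : (0 : ℝ) ≤ r := Nat.cast_nonneg r
    have hjr : ((j - r : ℕ) : ℝ) = j - r := by rw [Nat.cast_sub hrj]
    constructor
    · -- `(j - r + 1 - K) ≥ 3T/4 - T/8 + 1 - K ≥ T/2 ≥ (p/2)·#Fᶜ`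
      rw [le_div_iff₀ hV0, hjr]
      have h5 : pc n k / 2 * #((univ : Finset (Edge n)) \ F) ≤ pc n k / 2 * (n.choose 2 : ℕ) :=
        mul_le_mul_of_nonneg_left hVle (by positivity)
      have h6 : pc n k / 2 * ((n.choose 2 : ℕ) : ℝ) = T / 2 := by rw [hTdef]; ring
      linarith
    · -- `(j - r) ≤ 2T ≤ 4p · (C(n,2)/2) ≤ 4p · #Fᶜ`
      rw [div_le_iff₀ hV0, hjr]
      have h7 : 4 * pc n k * (((n.choose 2 : ℕ) : ℝ) / 2) ≤ 4 * pc n k * #((univ : Finset (Edge n)) \ F) :=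
        mul_le_mul_of_nonneg_left hVr (by positivity)
      have h8 : 4 * pc n k * (((n.choose 2 : ℕ) : ℝ) / 2) = 2 * T := by rw [hTdef]; ring
      linarith
  -- the `F`-avoiding `k`-sets are numerous: `#𝒜'·p^K ≥ 1/(2^k k!) - p/16 ≥ c₀`
  have hcount : 1 / (2 ^ (k + 1) * k.factorial) ≤
      #((powersetCard k (univ : Finset (Fin n))).filter fun A =>
        (univ.filter fun e : Edge n => cliqueVec A e = true) ⊆ univ \ F) * pc n k ^ k.choose 2 := by
    have h1 : (n.choose k : ℝ) ≤ #((powersetCard k (univ : Finset (Fin n))).filter fun A =>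
        (univ.filter fun e : Edge n => cliqueVec A e = true) ⊆ univ \ F) + #F * ((n - 2).choose (k - 2) : ℝ) := by
      exact_mod_cast fcl_choose_le_card_avoiding_add (k := k) F
    have h2 : 1 / (2 ^ k * k.factorial : ℝ) ≤ (n.choose k : ℝ) * pc n k ^ k.choose 2 := by
      have := le_choose_mul_threshold_pow hk2 (by omega : 2 * k ≤ n) (a := (1 : ℝ)) zero_le_one
      simpa only [one_pow, one_mul, pc] using this
    have h3 : (#F : ℝ) * ((n - 2).choose (k - 2) : ℝ) * pc n k ^ k.choose 2 ≤ pc n k / 16 := by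
      rw [pc_pow_choose hn1 hk2]
      have ha : ((n - 2).choose (k - 2) : ℝ) ≤ (n : ℝ) ^ (k - 2) := by
        have h₁ : (n - 2).choose (k - 2) ≤ (n - 2) ^ (k - 2) := Nat.choose_le_pow _ _
        have h₂ : (n - 2) ^ (k - 2) ≤ n ^ (k - 2) := Nat.pow_le_pow_left (Nat.sub_le n 2) _
        exact_mod_cast h₁.trans h₂
      have hk' : (n : ℝ) ^ k = (n : ℝ) ^ (k - 2) * n * n := by
        rw [← pow_succ, ← pow_succ]
        congr 1
        omega
      have hn0 : (0 : ℝ) < n := by linarith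
      have hinv : (0 : ℝ) ≤ ((n : ℝ) ^ k)⁻¹ := by positivity
      -- `#F ≤ T/8 = C(n,2)·p/8 ≤ n²·p/16`
      have hFle : (#F : ℝ) ≤ (n : ℝ) ^ 2 * pc n k / 16 := by
        have hN2 : ((n.choose 2 : ℕ) : ℝ) ≤ (n : ℝ) ^ 2 / 2 := by
          rw [Nat.cast_choose_two]; nlinarith
        have : T ≤ (n : ℝ) ^ 2 / 2 * pc n k := by
          rw [hTdef]; exact mul_le_mul_of_nonneg_right hN2 hp0.le
        linarith
      have hC0 : (0 : ℝ) ≤ ((n - 2).choose (k - 2) : ℝ) := Nat.cast_nonneg _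
      calc (#F : ℝ) * ((n - 2).choose (k - 2) : ℝ) * ((n : ℝ) ^ k)⁻¹
          ≤ ((n : ℝ) ^ 2 * pc n k / 16) * (n : ℝ) ^ (k - 2) * ((n : ℝ) ^ k)⁻¹ := by gcongr
        _ = pc n k / 16 := by
            rw [hk']
            field_simp
    have hpK : 0 ≤ pc n k ^ k.choose 2 := pow_nonneg (pc_nonneg n k) _
    have h4 := calc (n.choose k : ℝ) * pc n k ^ k.choose 2
        ≤ (#((powersetCard k (univ : Finset (Fin n))).filter fun A =>
            (univ.filter fun e : Edge n => cliqueVec A e = true) ⊆ univ \ F) +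
            #F * ((n - 2).choose (k - 2) : ℝ)) * pc n k ^ k.choose 2 := mul_le_mul_of_nonneg_right h1 hpK
      _ = #((powersetCard k (univ : Finset (Fin n))).filter fun A =>
            (univ.filter fun e : Edge n => cliqueVec A e = true) ⊆ univ \ F) * pc n k ^ k.choose 2 +
            (#F : ℝ) * ((n - 2).choose (k - 2) : ℝ) * pc n k ^ k.choose 2 := by ring
    have h5 : 1 / (2 ^ k * k.factorial : ℝ) = 2 * (1 / (2 ^ (k + 1) * k.factorial)) := by
      rw [pow_succ]
      field_simp
    linarith
  exact fcl_fibre_bound hk2 hn1 F ρ _ (fun A hA => mem_filter.1 hA) hc₀0 hcount hwin' hV hp0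

end

end Summit.PneNP.PneNP.Cruxes.SliceTarget.Ideator3Line
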